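import Mathlib.Analysis.SpecialFunctions.JapaneseBracket
import Mathlib.MeasureTheory.Measure.Haar.NormedSpace
import Literature.NumberTheory.Automorphic.AdelicHeightAffineLineAdele
import Literature.NumberTheory.Automorphic.IdeleClassGroupProofs
import Literature.NumberTheory.Automorphic.AdelicHeightZetaUniform
import HarnessLib

/-!
# Local bounds for the affine twist `η = (ξ + β)·u·ρ_s` of a rational point: archimedean coordinates, finite-place comparison

Topic `NumberTheory/Automorphic`; namespace `Literature.NumberTheory.Automorphic` (sequel of ★ `AdelicHeightAffineLineAdele`).
KERNEL only: proved theorems, no definition, no named fact, no `sorry`.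

For a number field `K`, `ξ ∈ K`, adeles `β, u` and the archimedean ray `ρ_s` (`posRealIdele`), put `η = ((ξ : 𝔸_K) + β)·u·ρ_s`.
* §1 The weight `y ↦ max(1, |c·y|)^{-N}` on `ℝ`: non-negative, `≤ 1`, `= 1` at `0`, even-antitone, integrable for `N > 1`
  (dominated by `2^N (1+|y|)^{-N}`, Mathlib `integrable_one_add_norm`), with `∫ max(1,|c y|)^{-N} dy = |c|⁻¹ ∫ max(1,|y|)^{-N} dy`.
* §2 At a REAL place `w`, in the coordinate `r_w : K_w ≃ ℝ` (Mathlib `Completion.extensionEmbeddingOfIsReal`, an isometry):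
  `|η_w| = |r_w(u_w) · ((r_w(β_w) + σ_w(ξ)) · s)|` (`norm_fst_affineTwist`).
* §3 At a finite place `v` (ultrametric): `max(1,|(x+b)u|_v) = max(1,|x|_v)` when `|b|_v ≤ 1 = |u|_v`, and in general
  `λ/max(1,B) · max(1,|x|_v) ≤ max(1, |(x+b)u|_v)` when `|b|_v ≤ B`, `0 < λ ≤ min(1, |u|_v)`.
* §4 For compact `K_F ⊆ 𝔸_K` and `U ⊆ 𝔸_Kˣ` there is `c > 0` with
  `c · Πᶠ_v max(1, |ξ|_v) ≤ Πᶠ_v max(1, |η_v|_v)` for all `β ∈ K_F`, `u ∈ U`, `s`, `ξ` (`exists_pos_mul_finprod_max_one_le_of_isCompact`;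
  a compact set of finite adeles is integral outside a finite `S`, ★ `exists_finset_forall_mem_adicCompletionIntegers_of_isCompact`).

These are the local adapters between the vector-height currency `h(1, η)` of the Fourier-side Eisenstein estimate and the lattice /
denominator counts ★ `TotallyRealIntegerTranslateSum`, ★ `DenominatorIdealRegrouping` [Weil1965, n° 41; Garrett2018, §2.2–2.3].
Cell `hodgecm-mathlib`, FLOOR 0, E-2 desk, crux item H413, row SW2c-BOUND (E3′).  HC_CM is proved only modulo the 7 printed
citations until rung 0 closes; this file is unconditional.

## References
* [Weil1965] A. Weil, *Sur la formule de Siegel dans la théorie des groupes classiques*, Acta Math. 113 (1965), n° 12 & 41.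
* [Garrett2018] P. Garrett, *Modern Analysis of Automorphic Forms by Example* (2018), §2.2–2.3.
-/

set_option autoImplicit false

noncomputable section

open scoped NNReal
open NumberField IsDedekindDomain NumberField.InfinitePlace NumberField.InfinitePlace.Completion
open _root_.MeasureTheory

namespace Literature.NumberTheory.Automorphic

/-! ## §1 The weight `max(1, |c y|)^{-N}` -/

section Weight

/-- `0 ≤ max(1,|y|)^{-N}`. [cite: Weil1965, n° 12] -/
theorem max_one_abs_rpow_neg_nonneg (N y : ℝ) : 0 ≤ (max 1 |y|) ^ (-N) :=
  Real.rpow_nonneg (le_trans zero_le_one (le_max_left _ _)) _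

/-- `max(1,|y|)^{-N} ≤ 1` for `N ≥ 0`. [cite: Weil1965, n° 12] -/
theorem max_one_abs_rpow_neg_le_one {N : ℝ} (hN : 0 ≤ N) (y : ℝ) : (max 1 |y|) ^ (-N) ≤ 1 :=
  Real.rpow_le_one_of_one_le_of_nonpos (le_max_left _ _) (by linarith)

/-- `max(1,|c·0|)^{-N} = 1`. [cite: Weil1965, n° 12] -/
theorem max_one_abs_mul_zero_rpow_neg (N c : ℝ) : (max 1 |c * 0|) ^ (-N) = 1 := by
  simp

/-- The weight `y ↦ max(1,|c y|)^{-N}` is even-antitone. [cite: Weil1965, n° 12] -/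
theorem max_one_abs_mul_rpow_neg_anti {N : ℝ} (hN : 0 ≤ N) (c : ℝ) {s t : ℝ} (hst : |s| ≤ |t|) :
    (max 1 |c * t|) ^ (-N) ≤ (max 1 |c * s|) ^ (-N) := by
  have h : max 1 |c * s| ≤ max 1 |c * t| := by
    rw [abs_mul, abs_mul]
    exact max_le_max le_rfl (mul_le_mul_of_nonneg_left hst (abs_nonneg c))
  exact Real.rpow_le_rpow_of_nonpos (lt_of_lt_of_le one_pos (le_max_left _ _)) h (by linarith)

/-- `y ↦ max(1,|y|)^{-N}` is integrable on `ℝ` for `N > 1`. [cite: Weil1965, n° 12] -/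
theorem integrable_max_one_abs_rpow_neg {N : ℝ} (hN : 1 < N) :
    Integrable (fun y : ℝ => (max 1 |y|) ^ (-N)) := by
  have h1 : Integrable (fun y : ℝ => (1 + ‖y‖) ^ (-N)) :=
    integrable_one_add_norm (by simpa using hN)
  refine (h1.const_mul ((2 : ℝ) ^ N)).mono' ?_ (ae_of_all _ fun y => ?_)
  · exact ((continuous_const.max continuous_abs).rpow_const
      fun y => Or.inl (ne_of_gt (lt_of_lt_of_le one_pos (le_max_left _ _)))).aestronglyMeasurable
  · rw [Real.norm_of_nonneg (max_one_abs_rpow_neg_nonneg N y)]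
    have hm : 0 < max 1 |y| := lt_of_lt_of_le one_pos (le_max_left _ _)
    have hle : 1 + ‖y‖ ≤ 2 * max 1 |y| := by
      rw [Real.norm_eq_abs]
      have h₁ := le_max_left 1 |y|
      have h₂ := le_max_right 1 |y|
      linarith
    have h2 : (2 * max 1 |y|) ^ (-N) ≤ (1 + ‖y‖) ^ (-N) :=
      Real.rpow_le_rpow_of_nonpos (by positivity) hle (by linarith)
    rw [Real.mul_rpow (by norm_num) hm.le] at h2
    calc (max 1 |y|) ^ (-N) = 2 ^ N * (2 ^ (-N) * (max 1 |y|) ^ (-N)) := by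
          rw [← mul_assoc, ← Real.rpow_add two_pos, add_neg_cancel, Real.rpow_zero, one_mul]
      _ ≤ 2 ^ N * (1 + ‖y‖) ^ (-N) := mul_le_mul_of_nonneg_left h2 (by positivity)

/-- `y ↦ max(1,|c y|)^{-N}` is integrable for `N > 1`, `c ≠ 0`. [cite: Weil1965, n° 12] -/
theorem integrable_max_one_abs_mul_rpow_neg {N : ℝ} (hN : 1 < N) {c : ℝ} (hc : c ≠ 0) :
    Integrable (fun y : ℝ => (max 1 |c * y|) ^ (-N)) :=
  (integrable_max_one_abs_rpow_neg hN).comp_mul_left' hc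

/-- Scaling: `∫ max(1,|c y|)^{-N} dy = |c⁻¹| · ∫ max(1,|y|)^{-N} dy`. [cite: Weil1965, n° 12] -/
theorem integral_max_one_abs_mul_rpow_neg (N c : ℝ) :
    ∫ y : ℝ, (max 1 |c * y|) ^ (-N) = |c⁻¹| * ∫ y : ℝ, (max 1 |y|) ^ (-N) := by
  have h := Measure.integral_comp_mul_left (fun y : ℝ => (max 1 |y|) ^ (-N)) c
  simpa only [smul_eq_mul] using h

/-- `max(1,|y|)^{-N} = (max(1,|y|)^{-1})^{N}`-type identity used to pass between `max(1,t)^{-N}` and `(max 1 t : ℝ≥0)`: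
`((max 1 t : ℝ≥0) : ℝ) ^ (-N) = (max 1 |t|) ^ (-N)` for `t : ℝ≥0`. [cite: Weil1965, n° 12] -/
theorem coe_max_one_rpow_neg (t : ℝ≥0) (N : ℝ) :
    ((max 1 t : ℝ≥0) : ℝ) ^ (-N) = (max 1 |(t : ℝ)|) ^ (-N) := by
  rw [NNReal.coe_max, NNReal.coe_one, abs_of_nonneg t.coe_nonneg]

end Weight

/-! ## §2 Archimedean coordinates at a real place -/

section Arch

variable (K : Type) [Field K] [NumberField K]

omit [NumberField K] in
/-- At a real place the norm on `K_w` is `|r_w(·)|` for the coordinate `r_w : K_w →+* ℝ`. [cite: Garrett2018, §2.2 (PDF p. 81)] -/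
theorem norm_eq_abs_extensionEmbeddingOfIsReal {w : InfinitePlace K} (hw : IsReal w) (z : w.Completion) :
    ‖z‖ = |extensionEmbeddingOfIsReal hw z| := by
  rw [← Real.norm_eq_abs, (AddMonoidHomClass.isometry_iff_norm _).1 (isometry_extensionEmbeddingOfIsReal hw) z]

omit [NumberField K] in
/-- `r_w(ξ) = σ_w(ξ)` for `ξ ∈ K`. [cite: Garrett2018, §2.2 (PDF p. 81)] -/
theorem extensionEmbeddingOfIsReal_coe_eq {w : InfinitePlace K} (hw : IsReal w) (k : K) :
    extensionEmbeddingOfIsReal hw (k : w.Completion) = embedding_of_isReal hw k := by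
  rw [show ((k : K) : w.Completion) = ((WithAbs.toAbs w.1 k : WithAbs w.1) : w.Completion) from rfl,
    extensionEmbeddingOfIsReal_coe]
  rfl

omit [NumberField K] in
/-- `r_w(ρ_t) = t` for the diagonal real scalar `t`. [cite: Garrett2018, §2.2 (PDF p. 81)] -/
theorem extensionEmbeddingOfIsReal_realToInfiniteAdele {w : InfinitePlace K} (hw : IsReal w) (t : ℝ) :
    extensionEmbeddingOfIsReal hw (realToInfiniteAdele K t w) = t := by
  apply Complex.ofReal_injective
  rw [extensionEmbeddingOfIsReal_apply, extensionEmbedding_realToInfiniteAdele_apply]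

/-- **`|η_w| = |r_w(u_w)·((r_w(β_w) + σ_w ξ)·s)|`** for `η = ((ξ:𝔸) + β)·u·ρ_s` at a real place `w`.
[cite: Garrett2018, §2.2 (PDF p. 81)] -/
theorem norm_fst_affineTwist {w : InfinitePlace K} (hw : IsReal w) (ξ : K) (β u : AdeleRing (𝓞 K) K) (s : ℝ≥0ˣ) :
    ‖((algebraMap K (AdeleRing (𝓞 K) K) ξ + β) * u *
        ((posRealIdele K s : (AdeleRing (𝓞 K) K)ˣ) : AdeleRing (𝓞 K) K)).1 w‖ =
      |extensionEmbeddingOfIsReal hw (u.1 w) *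
        ((extensionEmbeddingOfIsReal hw (β.1 w) + embedding_of_isReal hw ξ) * ((s : ℝ≥0) : ℝ))| := by
  rw [show ((algebraMap K (AdeleRing (𝓞 K) K) ξ + β) * u *
        ((posRealIdele K s : (AdeleRing (𝓞 K) K)ˣ) : AdeleRing (𝓞 K) K)).1 w =
      ((ξ : w.Completion) + β.1 w) * u.1 w * realToInfiniteAdele K (s : ℝ≥0) w from rfl,
    norm_eq_abs_extensionEmbeddingOfIsReal K hw, map_mul, map_mul, map_add,
    extensionEmbeddingOfIsReal_coe_eq, extensionEmbeddingOfIsReal_realToInfiniteAdele]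
  ring_nf

end Arch

/-! ## §3 Finite places: ultrametric comparison -/

section Finite

variable (K : Type) [Field K] [NumberField K]

/-- `max(1, |(x+b)u|_v) = max(1, |x|_v)` when `|b|_v ≤ 1` and `|u|_v = 1`. [cite: Garrett2018, §2.2 (PDF p. 82)] -/
theorem max_one_norm_add_mul_eq (v : HeightOneSpectrum (𝓞 K)) {x b u : v.adicCompletion K}
    (hb : ‖b‖ ≤ 1) (hu : ‖u‖ = 1) : max 1 ‖(x + b) * u‖ = max 1 ‖x‖ := by
  rw [norm_mul, hu, mul_one]
  apply le_antisymm
  · exact max_le (le_max_left _ _) ((IsUltrametricDist.norm_add_le_max x b).trans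
      (max_le (le_max_right _ _) (hb.trans (le_max_left _ _))))
  · refine max_le (le_max_left _ _) ?_
    have h : ‖x‖ = ‖(x + b) + (-b)‖ := by rw [add_neg_cancel_right]
    rw [h]
    refine (IsUltrametricDist.norm_add_le_max _ _).trans (max_le (le_max_right _ _) ?_)
    rw [norm_neg]
    exact hb.trans (le_max_left _ _)

/-- `λ/max(1,B) · max(1,|x|_v) ≤ max(1, |(x+b)u|_v)` when `|b|_v ≤ B` and `0 < λ ≤ min(1, |u|_v)`.
[cite: Garrett2018, §2.2 (PDF p. 82)] -/
theorem mul_max_one_norm_le_max_one_norm_add_mul (v : HeightOneSpectrum (𝓞 K)) {x b u : v.adicCompletion K}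
    {B lam : ℝ} (hlam : 0 < lam) (hlam1 : lam ≤ 1) (hb : ‖b‖ ≤ B) (hu : lam ≤ ‖u‖) :
    lam / max 1 B * max 1 ‖x‖ ≤ max 1 ‖(x + b) * u‖ := by
  have hB : 0 < max 1 B := lt_of_lt_of_le one_pos (le_max_left _ _)
  have hA : 1 ≤ max 1 ‖x + b‖ := le_max_left _ _
  have hB1 : 1 ≤ max 1 B := le_max_left _ _
  have h1 : max 1 ‖x‖ ≤ max 1 B * max 1 ‖x + b‖ := by
    have hx : ‖x‖ ≤ max ‖x + b‖ B := by
      have h : ‖x‖ = ‖(x + b) + (-b)‖ := by rw [add_neg_cancel_right]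
      rw [h]
      refine (IsUltrametricDist.norm_add_le_max _ _).trans (max_le_max le_rfl ?_)
      rw [norm_neg]
      exact hb
    refine max_le ?_ ?_
    · nlinarith
    · rcases le_max_iff.1 hx with h | h
      · calc ‖x‖ ≤ max 1 ‖x + b‖ := h.trans (le_max_right _ _)
          _ ≤ max 1 B * max 1 ‖x + b‖ := le_mul_of_one_le_left (by positivity) hB1
      · calc ‖x‖ ≤ max 1 B := h.trans (le_max_right _ _)
          _ ≤ max 1 B * max 1 ‖x + b‖ := le_mul_of_one_le_right hB.le hA
  have h2 : lam * max 1 ‖x + b‖ ≤ max 1 ‖(x + b) * u‖ := by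
    rw [norm_mul]
    rcases le_total ‖x + b‖ 1 with h | h
    · rw [max_eq_left h, mul_one]
      exact hlam1.trans (le_max_left _ _)
    · rw [max_eq_right h]
      calc lam * ‖x + b‖ ≤ ‖u‖ * ‖x + b‖ := mul_le_mul_of_nonneg_right hu (norm_nonneg _)
        _ = ‖x + b‖ * ‖u‖ := mul_comm _ _
        _ ≤ _ := le_max_right _ _
  calc lam / max 1 B * max 1 ‖x‖ ≤ lam / max 1 B * (max 1 B * max 1 ‖x + b‖) :=
        mul_le_mul_of_nonneg_left h1 (div_nonneg hlam.le hB.le)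
    _ = lam * max 1 ‖x + b‖ := by field_simp
    _ ≤ _ := h2

/-- the finite component of the affine twist: `η_v = (ξ + β_v)·u_v` (`ρ_s` is trivial at finite places). [cite: Garrett2018, §2.2 (PDF p. 82)] -/
theorem snd_affineTwist_apply (ξ : K) (β u : AdeleRing (𝓞 K) K) (s : ℝ≥0ˣ) (v : HeightOneSpectrum (𝓞 K)) :
    ((algebraMap K (AdeleRing (𝓞 K) K) ξ + β) * u *
        ((posRealIdele K s : (AdeleRing (𝓞 K) K)ˣ) : AdeleRing (𝓞 K) K)).2 v =
      ((ξ : v.adicCompletion K) + β.2 v) * u.2 v := by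
  rw [show ((algebraMap K (AdeleRing (𝓞 K) K) ξ + β) * u *
        ((posRealIdele K s : (AdeleRing (𝓞 K) K)ˣ) : AdeleRing (𝓞 K) K)).2 v =
      ((ξ : v.adicCompletion K) + β.2 v) * u.2 v *
        ((posRealIdele K s : (AdeleRing (𝓞 K) K)ˣ) : AdeleRing (𝓞 K) K).2 v from rfl,
    posRealIdele_snd_apply, mul_one]

/-- `|u_v|·|u_v⁻¹| = 1` for an idele `u`. [cite: Garrett2018, §2.2 (PDF p. 82)] -/
theorem norm_snd_mul_norm_snd_inv (u : (AdeleRing (𝓞 K) K)ˣ) (v : HeightOneSpectrum (𝓞 K)) :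
    ‖(u : AdeleRing (𝓞 K) K).2 v‖ * ‖((u⁻¹ : (AdeleRing (𝓞 K) K)ˣ) : AdeleRing (𝓞 K) K).2 v‖ = 1 := by
  rw [← norm_mul, show (u : AdeleRing (𝓞 K) K).2 v * ((u⁻¹ : (AdeleRing (𝓞 K) K)ˣ) : AdeleRing (𝓞 K) K).2 v =
    ((u * u⁻¹ : (AdeleRing (𝓞 K) K)ˣ) : AdeleRing (𝓞 K) K).2 v from rfl, mul_inv_cancel, Units.val_one]
  exact norm_one

/-! ## §4 Compact translates and dilations: `c · Πᶠ max(1,|ξ|_v) ≤ Πᶠ max(1,|η_v|_v)` -/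

/-- **Finite-place comparison, uniform over compacts.**  For compact `K_F ⊆ 𝔸_K` and `U ⊆ 𝔸_Kˣ` there is `c > 0` such that
for all `β ∈ K_F`, `u ∈ U`, `s` and `ξ ∈ K`, with `η = ((ξ:𝔸) + β)·u·ρ_s`:
`c · Πᶠ_v max(1, |ξ|_v) ≤ Πᶠ_v max(1, |η_v|_v)`. [cite: Garrett2018, Thm. 2.2.2 (PDF p. 82)] -/
theorem exists_pos_mul_finprod_max_one_le_of_isCompact {KF : Set (AdeleRing (𝓞 K) K)} (hKF : IsCompact KF)
    {U : Set (AdeleRing (𝓞 K) K)ˣ} (hU : IsCompact U) :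
    ∃ c : ℝ≥0, 0 < c ∧ ∀ β ∈ KF, ∀ u ∈ U, ∀ s : ℝ≥0ˣ, ∀ ξ : K,
      c * ∏ᶠ v : HeightOneSpectrum (𝓞 K), max 1 ‖(ξ : v.adicCompletion K)‖₊ ≤
        ∏ᶠ v : HeightOneSpectrum (𝓞 K),
          max 1 ‖(((algebraMap K (AdeleRing (𝓞 K) K) ξ + β) * (u : AdeleRing (𝓞 K) K) *
            ((posRealIdele K s : (AdeleRing (𝓞 K) K)ˣ) : AdeleRing (𝓞 K) K)).2 v)‖₊ := by
  classical
  -- integrality outside finite sets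
  obtain ⟨S₁, hS₁⟩ := exists_finset_forall_mem_adicCompletionIntegers_of_isCompact K (hKF.image continuous_snd)
  obtain ⟨S₂, hS₂⟩ := exists_finset_forall_mem_adicCompletionIntegers_of_isCompact K
    (hU.image (continuous_snd.comp Units.continuous_val))
  obtain ⟨S₃, hS₃⟩ := exists_finset_forall_mem_adicCompletionIntegers_of_isCompact K
    (hU.image (continuous_snd.comp Units.continuous_coe_inv))
  -- bounds at every place
  have hbβ : ∀ v : HeightOneSpectrum (𝓞 K), ∃ C : ℝ, ∀ β ∈ KF, ‖β.2 v‖ ≤ C := fun v =>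
    hKF.exists_bound_of_continuousOn (((RestrictedProduct.continuous_eval v).comp continuous_snd).continuousOn)
  choose Cβ hCβ using hbβ
  have hbu : ∀ v : HeightOneSpectrum (𝓞 K), ∃ C : ℝ, ∀ u ∈ U,
      ‖((u⁻¹ : (AdeleRing (𝓞 K) K)ˣ) : AdeleRing (𝓞 K) K).2 v‖ ≤ C := fun v =>
    hU.exists_bound_of_continuousOn
      (((RestrictedProduct.continuous_eval v).comp (continuous_snd.comp Units.continuous_coe_inv)).continuousOn)
  choose Cu hCu using hbu
  set S : Finset (HeightOneSpectrum (𝓞 K)) := S₁ ∪ S₂ ∪ S₃ with hSdef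
  set B : ℝ := ∑ v ∈ S, |Cβ v| with hBdef
  set Λ : ℝ := 1 + ∑ v ∈ S, |Cu v| with hΛdef
  have hΛ1 : 1 ≤ Λ := by
    rw [hΛdef]
    exact le_add_of_nonneg_right (Finset.sum_nonneg fun v _ => abs_nonneg _)
  have hΛ0 : 0 < Λ := lt_of_lt_of_le one_pos hΛ1
  have hB0 : 0 < max 1 B := lt_of_lt_of_le one_pos (le_max_left _ _)
  set c₀ : ℝ := Λ⁻¹ / max 1 B with hc₀def
  have hc₀ : 0 < c₀ := div_pos (inv_pos.2 hΛ0) hB0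
  -- facts off `S`
  have hβint : ∀ β ∈ KF, ∀ v, v ∉ S → ‖β.2 v‖ ≤ 1 := fun β hβ v hv =>
    (GaloisRepresentations.mem_adicCompletionIntegers_iff_norm_le_one (K := K) (v := v) (β.2 v)).1
      (hS₁ _ ⟨β, hβ, rfl⟩ v fun h => hv (by rw [hSdef]; simp [h]))
  have huone : ∀ u ∈ U, ∀ v, v ∉ S → ‖(u : AdeleRing (𝓞 K) K).2 v‖ = 1 := by
    intro u hu v hv
    have h1 : ‖(u : AdeleRing (𝓞 K) K).2 v‖ ≤ 1 :=
      (GaloisRepresentations.mem_adicCompletionIntegers_iff_norm_le_one (K := K) (v := v) _).1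
        (hS₂ _ ⟨u, hu, rfl⟩ v fun h => hv (by rw [hSdef]; simp [h]))
    have h2 : ‖((u⁻¹ : (AdeleRing (𝓞 K) K)ˣ) : AdeleRing (𝓞 K) K).2 v‖ ≤ 1 :=
      (GaloisRepresentations.mem_adicCompletionIntegers_iff_norm_le_one (K := K) (v := v) _).1
        (hS₃ _ ⟨u, hu, rfl⟩ v fun h => hv (by rw [hSdef]; simp [h]))
    have h3 := norm_snd_mul_norm_snd_inv K u v
    apply le_antisymm h1
    by_contra hlt
    have h4 := mul_lt_one_of_nonneg_of_lt_one_left (norm_nonneg _) (not_le.mp hlt) h2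
    linarith
  -- lower bound for `|u_v|_v` on `S`
  have hulow : ∀ u ∈ U, ∀ v ∈ S, Λ⁻¹ ≤ ‖(u : AdeleRing (𝓞 K) K).2 v‖ := by
    intro u hu v hv
    have h3 := norm_snd_mul_norm_snd_inv K u v
    have hle : ‖((u⁻¹ : (AdeleRing (𝓞 K) K)ˣ) : AdeleRing (𝓞 K) K).2 v‖ ≤ Λ :=
      (hCu v u hu).trans ((le_abs_self _).trans
        ((Finset.single_le_sum (fun w _ => abs_nonneg (Cu w)) hv).trans (by rw [hΛdef]; linarith)))
    have hpos : 0 < ‖((u⁻¹ : (AdeleRing (𝓞 K) K)ˣ) : AdeleRing (𝓞 K) K).2 v‖ := by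
      rcases (norm_nonneg (((u⁻¹ : (AdeleRing (𝓞 K) K)ˣ) : AdeleRing (𝓞 K) K).2 v)).lt_or_eq with h | h
      · exact h
      · rw [← h, mul_zero] at h3
        exact absurd h3 zero_ne_one
    calc Λ⁻¹ ≤ (‖((u⁻¹ : (AdeleRing (𝓞 K) K)ˣ) : AdeleRing (𝓞 K) K).2 v‖)⁻¹ := inv_anti₀ hpos hle
      _ = ‖(u : AdeleRing (𝓞 K) K).2 v‖ := (eq_inv_of_mul_eq_one_left h3).symm
  -- bound for `|β_v|_v` on `S`
  have hβS : ∀ β ∈ KF, ∀ v ∈ S, ‖β.2 v‖ ≤ B := fun β hβ v hv =>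
    (hCβ v β hβ).trans ((le_abs_self _).trans (Finset.single_le_sum (fun w _ => abs_nonneg (Cβ w)) hv))
  -- the constant `c = c₀ ^ #S`
  set c₁ : ℝ≥0 := ⟨c₀, hc₀.le⟩ with hc₁def
  have hc₁ : (0 : ℝ≥0) < c₁ := by
    rw [hc₁def, ← NNReal.coe_lt_coe]
    exact hc₀
  refine ⟨c₁ ^ S.card, pow_pos hc₁ _, fun β hβ u hu s ξ => ?_⟩
  set η : AdeleRing (𝓞 K) K := (algebraMap K (AdeleRing (𝓞 K) K) ξ + β) * (u : AdeleRing (𝓞 K) K) *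
    ((posRealIdele K s : (AdeleRing (𝓞 K) K)ˣ) : AdeleRing (𝓞 K) K) with hηdef
  set d : HeightOneSpectrum (𝓞 K) → ℝ≥0 := fun v => max 1 ‖(ξ : v.adicCompletion K)‖₊ with hd
  set f : HeightOneSpectrum (𝓞 K) → ℝ≥0 := fun v => max 1 ‖η.2 v‖₊ with hf
  have hηv : ∀ v, η.2 v = ((ξ : v.adicCompletion K) + β.2 v) * (u : AdeleRing (𝓞 K) K).2 v := fun v => by
    rw [hηdef, snd_affineTwist_apply]
  have hoff : ∀ v, v ∉ S → f v = d v := fun v hv => by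
    simp only [hf, hd]
    rw [← NNReal.coe_inj]
    push_cast
    rw [hηv, max_one_norm_add_mul_eq K v (hβint β hβ v hv) (huone u hu v hv)]
  have hon : ∀ v ∈ S, c₁ * d v ≤ f v := fun v hv => by
    simp only [hf, hd, hc₁def]
    rw [← NNReal.coe_le_coe]
    push_cast
    rw [hηv]
    exact mul_max_one_norm_le_max_one_norm_add_mul K v (inv_pos.2 hΛ0) (inv_le_one_of_one_le₀ hΛ1)
      (hβS β hβ v hv) (hulow u hu v hv)
  -- finite supports and the comparison of finite products
  have hdfin : (Function.mulSupport d).Finite :=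
    hasFiniteMulSupport_max_one_nnnorm_snd K (algebraMap K (AdeleRing (𝓞 K) K) ξ)
  have hffin : (Function.mulSupport f).Finite := hasFiniteMulSupport_max_one_nnnorm_snd K η
  set T : Finset (HeightOneSpectrum (𝓞 K)) := S ∪ hdfin.toFinset ∪ hffin.toFinset with hT
  have hST : S ⊆ T := by
    rw [hT]
    exact Finset.subset_union_left.trans Finset.subset_union_left
  have hdT : Function.mulSupport d ⊆ ↑T := fun v hv => by
    rw [hT, Finset.coe_union, Finset.coe_union]
    exact Or.inl (Or.inr (hdfin.mem_toFinset.2 hv))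
  have hfT : Function.mulSupport f ⊆ ↑T := fun v hv => by
    rw [hT, Finset.coe_union]
    exact Or.inr (hffin.mem_toFinset.2 hv)
  rw [finprod_eq_prod_of_mulSupport_subset d hdT, finprod_eq_prod_of_mulSupport_subset f hfT,
    ← Finset.prod_sdiff hST, ← Finset.prod_sdiff hST]
  have h1 : ∏ v ∈ T \ S, d v = ∏ v ∈ T \ S, f v :=
    Finset.prod_congr rfl fun v hv => (hoff v (Finset.mem_sdiff.1 hv).2).symm
  have h2 : c₁ ^ S.card * ∏ v ∈ S, d v ≤ ∏ v ∈ S, f v := by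
    rw [← Finset.prod_const, ← Finset.prod_mul_distrib]
    exact Finset.prod_le_prod' fun v hv => hon v hv
  calc c₁ ^ S.card * ((∏ v ∈ T \ S, d v) * ∏ v ∈ S, d v)
      = (∏ v ∈ T \ S, f v) * (c₁ ^ S.card * ∏ v ∈ S, d v) := by rw [h1]; ring
    _ ≤ (∏ v ∈ T \ S, f v) * ∏ v ∈ S, f v := mul_le_mul_of_nonneg_left h2 bot_le

end Finite

end Literature.NumberTheory.Automorphic
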